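import Mathlib.Analysis.SpecialFunctions.Log.Basic
import Mathlib.Analysis.SpecialFunctions.Pow.Real
import Mathlib.Data.Nat.Choose.Basic
import Mathlib.Data.Nat.Find
import Mathlib.Tactic
import HarnessLib

/-!
# Roy's small value estimate for `𝔾ₐ × 𝔾ₘ` — the auxiliary integer parameters `L` and `k` of §§3–4

Topic `Literature/NumberTheory/Transcendental`. Part of the formalisation of the proof of Roy 2013,
Theorem 1.1 (named fact `roy2013_thm_1_1`, `RoySmallValueEstimates.lean`), seat B. Source: D. Roy,
*A small value estimate for `𝔾ₐ × 𝔾ₘ`*, Mathematika 59 (2013) 333–363 = arXiv:1301.0663, §3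
(Prop. 3.3: "let `L` be the integer for which `binom(L+1,2) < T ≤ binom(L+2,2)`") and §4 (proof of
Prop. 4.2: "let `k` be the smallest integer such that `(3/2)^k D ≥ T`", p. 12):

> Since `T ≤ binom(D+1, 2)`, we have `L < D` [...] we find `k ≤ 1 + log(T/D)/log(3/2)` [...]

The statements of this development (`prop_4_5_i/ii`, `prop_6_1`, `le_mult_of_mem_vanIdeal`,
`exists_test_near`, …) carry these integers as parameters with the side conditions
`binom(L+1,2) < T ≤ binom(L+2,2)`, `L < D` (or `3(L+1) ≤ D`), `2^k T ≤ 3^k D`. This file provides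
them: `exists_choose_window` (existence of `L` for `T ≥ 1`), `window_lt` (`L < D` when
`T ≤ binom(D+1,2)`), `three_mul_window_succ_le` (`3(L+1) ≤ D` when `36T ≤ D²`), `exists_ratio_k`
(the minimal `k`, with `k ≤ 1 + log(T/D)/log(3/2)`). Everything is proved; no definitions, no
named facts.

## References

* [Roy2013] D. Roy, *A small value estimate for 𝔾ₐ × 𝔾ₘ*, Mathematika 59 (2013), 333–363
  (arXiv:1301.0663), §3 (Prop. 3.3) and §4 (proof of Prop. 4.2).
-/

namespace Literature.NumberTheory.Transcendental

namespace Roy2013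

/-! ### The interpolation window `binom(L+1,2) < T ≤ binom(L+2,2)` -/

/-- **Existence of `L`** with `binom(L+1,2) < T ≤ binom(L+2,2)`, for `T ≥ 1`.
[cite: Roy2013, Proposition 3.3 ("the integer for which `binom(L+1,2) < T ≤ binom(L+2,2)`")] -/
theorem exists_choose_window {T : ℕ} (hT : 1 ≤ T) : ∃ L : ℕ, (L + 1).choose 2 < T ∧ T ≤ (L + 2).choose 2 := by
  classical
  have hex : ∃ L : ℕ, T ≤ (L + 2).choose 2 := by
    refine ⟨T, ?_⟩
    rw [Nat.choose_two_right]
    -- `T ≤ (T+2)(T+1)/2`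
    apply Nat.le_div_iff_mul_le (by norm_num) |>.mpr
    have : T + 2 - 1 = T + 1 := by omega
    rw [this]
    nlinarith
  refine ⟨Nat.find hex, ?_, Nat.find_spec hex⟩
  rcases Nat.eq_zero_or_pos (Nat.find hex) with h0 | hpos
  · rw [h0]; simp only [zero_add, Nat.choose_succ_self]; omega
  · have hmin := Nat.find_min hex (Nat.sub_one_lt_of_lt hpos)
    rw [not_le] at hmin
    have : Nat.find hex - 1 + 2 = Nat.find hex + 1 := by omega
    rwa [this] at hmin

/-- **`L < D`** when `T ≤ binom(D+1, 2)`. [cite: Roy2013, proof of Proposition 3.3 ("Since `T ≤ binom(D+1,2)`, we have `L < D`")] -/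
theorem window_lt {L T D : ℕ} (hw : (L + 1).choose 2 < T) (hT : T ≤ (D + 1).choose 2) : L < D := by
  by_contra h
  push Not at h
  have hmono : (D + 1).choose 2 ≤ (L + 1).choose 2 := Nat.choose_le_choose 2 (by omega)
  omega

/-- `(L+1)² ≤ 4T` on the window. [folklore] -/
theorem window_succ_sq_le {L T : ℕ} (hw : (L + 1).choose 2 < T) : (L + 1) ^ 2 ≤ 4 * T := by
  have h := Nat.choose_two_right (L + 1)
  simp only [Nat.add_sub_cancel] at h
  -- `(L+1) L / 2 < T`, so `(L+1) L < 2T`, and `(L+1)² ≤ 2 (L+1) L + 1 ≤ 4T`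
  have h1 : (L + 1) * L < 2 * T := by
    rw [h] at hw
    have := Nat.div_lt_iff_lt_mul (by norm_num : 0 < 2) |>.mp hw
    linarith
  nlinarith

/-- **`3(L+1) ≤ D`** when `36 T ≤ D²` (the hypothesis `3(L+1) ≤ D` of `prop_4_5`).
[cite: Roy2013, Proposition 4.2 (hypotheses on `L`, `D`)] -/
theorem three_mul_window_succ_le {L T D : ℕ} (hw : (L + 1).choose 2 < T) (h : 36 * T ≤ D ^ 2) :
    3 * (L + 1) ≤ D := by
  have h1 := window_succ_sq_le hw
  have h2 : (3 * (L + 1)) ^ 2 ≤ D ^ 2 := by nlinarith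
  exact (Nat.pow_le_pow_iff_left (by norm_num)).mp h2

/-! ### The integer `k` with `2^k T ≤ 3^k D` -/

/-- `T ≤ (3/2)^T` in the form `2^T T ≤ 3^T`. [folklore] -/
theorem two_pow_mul_le_three_pow (T : ℕ) : 2 ^ T * T ≤ 3 ^ T := by
  induction T with
  | zero => simp
  | succ n ih =>
    rcases Nat.eq_zero_or_pos n with rfl | hn
    · norm_num
    · -- `2^{n+1}(n+1) = 2·2^n·(n+1) ≤ 2·2^n·(3n/2)`… elementary: `2 (n+1) ≤ 3 n` for `n ≥ 2`
      rcases Nat.lt_or_ge n 2 with hlt | hge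
      · interval_cases n; norm_num
      · calc 2 ^ (n + 1) * (n + 1) = 2 * (2 ^ n * (n + 1)) := by ring
          _ ≤ 2 * (2 ^ n * n) + 2 * 2 ^ n := by ring_nf; omega
          _ ≤ 3 * (2 ^ n * n) := by nlinarith [Nat.one_le_two_pow (n := n)]
          _ ≤ 3 * 3 ^ n := by nlinarith
          _ = 3 ^ (n + 1) := by ring

/-- **Existence of the minimal `k` with `2^k T ≤ 3^k D`** (`1 ≤ D ≤ T`), with Roy's bound
`k ≤ 1 + log(T/D)/log(3/2)`. [cite: Roy2013, proof of Proposition 4.2 ("the smallest integer such that `(3/2)^k D ≥ T`")] -/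
theorem exists_ratio_k {T D : ℕ} (hD : 1 ≤ D) (hDT : D ≤ T) :
    ∃ k : ℕ, 2 ^ k * T ≤ 3 ^ k * D ∧
      (k : ℝ) ≤ 1 + Real.log ((T : ℝ) / D) / Real.log (3 / 2) := by
  classical
  have hex : ∃ k : ℕ, 2 ^ k * T ≤ 3 ^ k * D :=
    ⟨T, (two_pow_mul_le_three_pow T).trans (Nat.le_mul_of_pos_right _ hD)⟩
  refine ⟨Nat.find hex, Nat.find_spec hex, ?_⟩
  have hlog32 : 0 < Real.log (3 / 2) := Real.log_pos (by norm_num)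
  have hDr : (0 : ℝ) < D := by exact_mod_cast hD
  have hTD : (1 : ℝ) ≤ (T : ℝ) / D := by
    rw [le_div_iff₀ hDr, one_mul]; exact_mod_cast hDT
  have hlogTD : 0 ≤ Real.log ((T : ℝ) / D) := Real.log_nonneg hTD
  rcases Nat.eq_zero_or_pos (Nat.find hex) with h0 | hpos
  · rw [h0, Nat.cast_zero]
    have := div_nonneg hlogTD hlog32.le
    linarith
  · have hmin := Nat.find_min hex (Nat.sub_one_lt_of_lt hpos)
    rw [not_le] at hmin
    have hreal : (3 : ℝ) ^ (Nat.find hex - 1) * D < (2 : ℝ) ^ (Nat.find hex - 1) * T := by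
      exact_mod_cast hmin
    have h32 : ((3 : ℝ) / 2) ^ (Nat.find hex - 1) < (T : ℝ) / D := by
      rw [div_pow, div_lt_div_iff₀ (pow_pos two_pos _) hDr]
      calc (3 : ℝ) ^ (Nat.find hex - 1) * D < 2 ^ (Nat.find hex - 1) * T := hreal
        _ = T * 2 ^ (Nat.find hex - 1) := mul_comm _ _
    have hlog := Real.log_lt_log (pow_pos (by norm_num) _) h32
    rw [Real.log_pow] at hlog
    have h1 : (((Nat.find hex - 1 : ℕ)) : ℝ) < Real.log ((T : ℝ) / D) / Real.log (3 / 2) := by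
      rw [lt_div_iff₀ hlog32]; exact hlog
    have hk1 : ((Nat.find hex - 1 : ℕ) : ℝ) = (Nat.find hex : ℝ) - 1 := by
      rw [Nat.cast_sub (Nat.one_le_iff_ne_zero.mpr hpos.ne'), Nat.cast_one]
    linarith

end Roy2013

end Literature.NumberTheory.Transcendental
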